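import Summits.QuantumFields.BalabanUV.T4Continuum.Support.NE7SymmetricFermatLevels
import Summits.QuantumFields.BalabanUV.T4Continuum.Support.NE7SymmetricCriticality
import Summits.QuantumFields.BalabanUV.T4Continuum.Support.NE7SymmetricAdmissibleWitness
import Summits.QuantumFields.BalabanUV.T4Continuum.Support.NE7MinimiserTensionPairing
import Summits.QuantumFields.BalabanUV.T4Continuum.Support.MinimalActionLimit
import Summits.QuantumFields.BalabanUV.T4Continuum.Support.AveragingDeficitMultiLevelBridge
import HarnessLib

/-!
# NE7StabiliserLiftingPrep — THE SYMMETRIC RESTRICTED MINIMISER IS TANGENT-CRITICAL (every `d`, every `U(n)`, every `L ≥ 2`): interiority from the action of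
# the symmetric witness, restricted Fermat at every level in the currency of `NE7OpenOfMinimisation.tanCritical_of_isMinimiser`, and Palais' symmetric
# criticality — the penultimate step of the STABILISER LIFTING theorem (`NE7StabiliserLifting`, `d = 4`)

Cell `pub-balaban`, rung (B)+1 sub-cell t4, lineage `b2b-balaban-t4-ne7b-p1` (row NE7b OWNER + CRUX PROVER; junction service for row NE7, ruling
R-OWNER-149-1 (2)), generation 158.  File 6 of the junction census of ROAD-G114 §8's STABILISER DESIGN ISSUE (files 1–5: `NE7InvariantFunctionalLetter`,
`NE7SymmetricCriticality`, `NE7SymmetricAdmissibleWitness`, `NE7SymmetricFermat`, `NE7SymmetricFermatLevels`).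
THE ARGUMENT.  `K` a set of unitary `N`-periodic coarse gauge transformations fixing the datum `V`, lifted block-constantly to level `k+1`
(`x ↦ s(⌊x∕L^{k+1}⌋)`, unitary and `(N·L^{k+1})`-periodic).  (i) INTERIORITY FROM THE ACTION: a unitary periodic `U` whose level action does not exceed that of a
configuration with plaquette radius `r` has plaquette radius `≤ √(card n·(N·L^{k+1})^d·#Plane)·r` (`‖W − 1‖² ≤ card n·nhsNormSq(W − 1) = 2·card n·wt W` for
unitary `W`; `MinimalActionLimit.levelAction_le_of_smallField`) — so the symmetric restricted minimiser over the slab witness of a small datum is INTERIOR.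
(ii) RESTRICTED FERMAT (`NE7SymmetricFermatLevels`, levels `1` and `j+2`) in the tangent currency: an interior configuration minimising the level action
among the lifted-`K`-FIXED admissible configurations is critical along every lifted-`K`-invariant skew periodic tangent direction.  (iii) SYMMETRIC CRITICALITY
(`NE7SymmetricCriticality.dAction_eq_zero_of_symmetric`): it is then critical along EVERY skew periodic tangent direction.
WHAT ([folklore]; 0 def, 0 sorry).  §1 `isUnitarySite_lift`, `isPeriodicSite_lift`, `lift_smul_pow`; §2 `norm_sub_one_sq_le_of_unitary`, `smallField_of_perWin`,
**`smallField_of_levelAction_le`**; §3 **`tanCritical_of_isRestrictedMinimiser`** (restricted Fermat, all levels); §4 **`tanCritical_of_symmetricRestrictedMinimiser`**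
(full tangent-criticality).
HONEST FRAMING (page 1): bookkeeping over this lineage's files 1–5 and NE3-R2's Fermat; no estimate of Bałaban's; NOT NE7, NOT NE3, row NE7b NOT PRINTED ∕ NOT
PROVED; spine 0∕9; finite T⁴ rung (B)+1 — NOT infinite volume, NOT mass gap, NOT BetaPertH, NOT Clay (continuum YM on T⁴ ⇐ BetaPertH ∧ nine spine estimates).
-/

set_option autoImplicit false

open scoped BigOperators Matrix Matrix.Norms.L2Operator Topology
open NormedSpace Finset Filter

namespace Summit.QuantumFields.BalabanUV.T4Continuum.NE7StabiliserLiftingPrep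

open Literature.MathematicalPhysics.QuantumFieldTheory.Balaban1983to89
open B7Prop1Explicit B7Prop2Explicit MatrixLog UnitaryModel MatrixNorms
open T4AveragingDeficitWall hiding Site Plane Plaq Bond
open T4AveragingDeficitWallBoundary (IsPeriodicCfg periodBox)
open AveragingDeficitPeriodicCounting (IsPeriodicDir)
open AveragingDeficitTransport (mem_U1_of_unitary)
open AveragingDeficitTorusChart (eq_wrap_add)
open AveragingDeficitFermat (isPeriodicCfg_cavg hol_add_smul boxVec_redN_mem)
open AveragingDeficitTwoLevelPrep (smallness_of_twoLevelSmall cavg_isUnitaryCfg)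
open AveragingDeficitChartCalculus (cavg)
open AveragingDeficitMultiLevelPrep (tower cavgIter cpush LevelSmall TangentIter)
open AveragingDeficitMultiLevelBridge (cavgIter_eq_avgIter)
open MinimalActionLevels (levelAction perWin stepWt stepWt_pos blockWindow_periodBox_snd wt_nonneg_of_unitary)
open MinimalActionSandwich (admissible)
open MinimalActionRate (sfClass)
open MinimalActionLimit (levelAction_le_of_smallField)
open NE3HessForm (dAction)
open NE3EnergyShapes (IsUnitarySite IsPeriodicSite)
open NE7ExactCurrent (dAction_eq_zero_of_critical)
open NE7MinimiserTensionPairing (period_eq period_eq_int blockWindow_snd_eq)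
open NE7SymmetricFermatLevels (hasDerivAt_fineAction_vary_multiLevel_symmetric hasDerivAt_fineAction_vary_oneLevel_symmetric)
open NE7SymmetricCriticality (dAction_eq_zero_of_symmetric)

noncomputable section

variable {d : ℕ} {n : Type*} [Fintype n] [DecidableEq n]

/-! ## §1 The block-constant lift of a coarse gauge transformation -/

/-- The block-constant lift of a unitary site field is unitary. [folklore] -/
theorem isUnitarySite_lift {s : Site d → (Matrix n n ℂ)ˣ} (hs : IsUnitarySite s) (M : ℤ) :
    IsUnitarySite (fun x : Site d => s (fun i => x i / M)) := fun _ => hs _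

/-- The block-constant lift at scale `M ≥ 1` of an `N`-periodic site field is `(N·M)`-periodic. [folklore] -/
theorem isPeriodicSite_lift {s : Site d → (Matrix n n ℂ)ˣ} {N : ℕ} (hsP : IsPeriodicSite s (N : ℤ)) {M : ℕ} (hM : 1 ≤ M) :
    IsPeriodicSite (fun x : Site d => s (fun i => x i / (M : ℤ))) ((N * M : ℕ) : ℤ) := by
  intro x j
  have hM0 : (M : ℤ) ≠ 0 := by exact_mod_cast (by omega : M ≠ 0)
  have h : (fun i => (x + ((N * M : ℕ) : ℤ) • e j) i / (M : ℤ)) = (fun i => x i / (M : ℤ)) + (N : ℤ) • e j := by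
    funext i
    simp only [Pi.add_apply, Pi.smul_apply, smul_eq_mul]
    have e1 : x i + ((N * M : ℕ) : ℤ) * e j i = x i + ((N : ℤ) * e j i) * (M : ℤ) := by push_cast; ring
    rw [e1, Int.add_mul_ediv_right _ _ hM0]
  show s (fun i => (x + ((N * M : ℕ) : ℤ) • e j) i / (M : ℤ)) = s (fun i => x i / (M : ℤ))
  rw [h, hsP]

/-- The lift read at a block corner: `ŝ(M•z) = s(z)`. [folklore] -/
theorem lift_smul {s : Site d → (Matrix n n ℂ)ˣ} {M : ℕ} (hM : 1 ≤ M) (z : Site d) :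
    (fun x : Site d => s (fun i => x i / (M : ℤ))) ((M : ℤ) • z) = s z := by
  have hM0 : (M : ℤ) ≠ 0 := by exact_mod_cast (by omega : M ≠ 0)
  show s (fun i => ((M : ℤ) • z) i / (M : ℤ)) = s z
  congr 1
  funext i
  simp only [Pi.smul_apply, smul_eq_mul]
  rw [mul_comm, Int.mul_ediv_cancel _ hM0]

/-! ## §2 Interiority from the action -/

/-- `‖W − 1‖² ≤ 2·card n·wt W` for unitary `W` (`‖·‖²_op ≤ card n·nhsNormSq`, B12 (0.14)). [folklore] -/
theorem norm_sub_one_sq_le_of_unitary [Nonempty n] {W : (Matrix n n ℂ)ˣ} (hW : W ∈ unitaryUnits (Matrix n n ℂ)) :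
    ‖(W : Matrix n n ℂ) - 1‖ ^ 2 ≤ 2 * (Fintype.card n : ℝ) * wt W := by
  have h1 := opNorm_sq_le_card_mul_nhsNormSq ((W : Matrix n n ℂ) - 1)
  have h2 := nhsNormSq_sub_one_of_mem_unitaryGroup (n := n) (U := (W : Matrix n n ℂ)) (mem_unitaryUnits.mp hW)
  rw [h2] at h1
  unfold wt
  linarith

/-- **SMALL-FIELD FROM THE ORDERED PLAQUETTES OF THE PERIOD WINDOW**: for a unitary `P`-periodic `U`, a bound `‖U(∂p) − 1‖ ≤ r` on the plaquettes of `perWin d P`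
(ordered planes `κ < κ′`, bases in `[0,P)^d`) gives `SmallField U r` (reversed plaquettes are inverses; periodicity). [folklore] -/
theorem smallField_of_perWin [Nonempty n] {P : ℕ} [NeZero P] {U : Site d → Fin d → (Matrix n n ℂ)ˣ} (hU : IsUnitaryCfg U)
    (hUP : IsPeriodicCfg U (P : ℤ)) {r : ℝ} (h : ∀ p ∈ perWin d P, ‖((fhol U p : (Matrix n n ℂ)ˣ) : Matrix n n ℂ) - 1‖ ≤ r) :
    SmallField U r := by
  -- ordered planes at every base of the window
  have hlt : ∀ x ∈ periodBox (d := d) P, ∀ κ κ' : Fin d, κ < κ' → ‖((hol U x (plaqWord κ κ') : (Matrix n n ℂ)ˣ) : Matrix n n ℂ) - 1‖ ≤ r := by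
    intro x hx κ κ' hκ
    exact h ⟨x, ⟨(κ, κ'), hκ⟩⟩ (Finset.mem_product.mpr ⟨hx, Finset.mem_univ _⟩)
  refine NE7OpenOfMinimisation.smallField_of_window hUP fun x hx κ κ' hκκ' => ?_
  rcases lt_or_gt_of_ne hκκ' with hlt' | hgt
  · exact hlt x hx κ κ' hlt'
  · -- the reversed plaquette is the inverse of the ordered one
    rw [SkeletonFillFullSmall.hol_plaqWord_swap U x κ' κ]
    set W := hol U x (plaqWord κ' κ) with hW
    have hWu : W ∈ unitaryUnits (Matrix n n ℂ) := hol_mem_of hU _ _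
    have h1 := hlt x hx κ' κ hgt
    have hinv : ‖(((W⁻¹ : (Matrix n n ℂ)ˣ)) : Matrix n n ℂ)‖ ≤ 1 := (mem_U1_of_unitary hWu).2
    calc ‖((W⁻¹ : (Matrix n n ℂ)ˣ) : Matrix n n ℂ) - 1‖
        = ‖((W⁻¹ : (Matrix n n ℂ)ˣ) : Matrix n n ℂ) * (1 - (W : Matrix n n ℂ))‖ := by
          rw [mul_sub, mul_one, Units.inv_mul]
      _ ≤ ‖((W⁻¹ : (Matrix n n ℂ)ˣ) : Matrix n n ℂ)‖ * ‖(1 : Matrix n n ℂ) - (W : Matrix n n ℂ)‖ := norm_mul_le _ _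
      _ ≤ 1 * ‖(W : Matrix n n ℂ) - 1‖ := by rw [norm_sub_rev]; exact mul_le_mul_of_nonneg_right hinv (norm_nonneg _)
      _ ≤ r := by rw [one_mul]; exact h1

/-- **INTERIORITY FROM THE ACTION**: a unitary `(N·L^k)`-periodic `U` whose level-`k` action does not exceed that of a unitary configuration `W` with `SmallField W r`
(`0 ≤ r`) has `SmallField U (√(card n·(N·L^k)^d·#Plane)·r)`. [folklore] -/
theorem smallField_of_levelAction_le [Nonempty n] {L N k : ℕ} [NeZero (N * L ^ k)] (hL : 1 ≤ L) {U W : Site d → Fin d → (Matrix n n ℂ)ˣ}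
    (hU : IsUnitaryCfg U) (hUP : IsPeriodicCfg U ((N * L ^ k : ℕ) : ℤ)) (hW : IsUnitaryCfg W) {r : ℝ} (hr : 0 ≤ r) (hWr : SmallField W r)
    (hle : levelAction d L N k U ≤ levelAction d L N k W) :
    SmallField U (Real.sqrt ((Fintype.card n : ℝ) * (((N * L ^ k : ℕ) : ℝ) ^ d * Fintype.card (T4AveragingDeficitWall.Plane d))) * r) := by
  have hc : 0 < ((stepWt d L)⁻¹) ^ k := pow_pos (inv_pos.mpr (stepWt_pos (d := d) L hL)) _
  have hup := hle.trans (levelAction_le_of_smallField L N k hL hW hWr)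
  set D : ℝ := ((N * L ^ k : ℕ) : ℝ) ^ d * Fintype.card (T4AveragingDeficitWall.Plane d) with hD
  have hD0 : 0 ≤ D := by rw [hD]; positivity
  refine smallField_of_perWin hU hUP fun p hp => ?_
  -- the single plaquette weight is at most the whole action
  have hsingle : wt (fhol U p) ≤ D * (r ^ 2 / 2) := by
    have h1 : ((stepWt d L)⁻¹) ^ k * wt (fhol U p) ≤ ((stepWt d L)⁻¹) ^ k * fineAction U (perWin d (N * L ^ k)) := by
      refine mul_le_mul_of_nonneg_left ?_ hc.le
      unfold fineAction
      exact Finset.single_le_sum (f := fun q => wt (fhol U q)) (fun q _ => wt_nonneg_of_unitary (hol_mem_of hU _ _)) hp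
    have h2 : ((stepWt d L)⁻¹) ^ k * fineAction U (perWin d (N * L ^ k)) ≤ ((stepWt d L)⁻¹) ^ k * (D * (r ^ 2 / 2)) := hup
    exact le_of_mul_le_mul_left (h1.trans h2) hc
  have hsq : ‖((fhol U p : (Matrix n n ℂ)ˣ) : Matrix n n ℂ) - 1‖ ^ 2 ≤ (Real.sqrt ((Fintype.card n : ℝ) * D) * r) ^ 2 := by
    have h1 := norm_sub_one_sq_le_of_unitary (n := n) (hol_mem_of hU p.1 (plaqWord p.2.1.1 p.2.1.2))
    have hcn : (0 : ℝ) ≤ Fintype.card n := Nat.cast_nonneg _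
    rw [mul_pow, Real.sq_sqrt (by positivity)]
    calc ‖((fhol U p : (Matrix n n ℂ)ˣ) : Matrix n n ℂ) - 1‖ ^ 2 ≤ 2 * (Fintype.card n : ℝ) * wt (fhol U p) := h1
      _ ≤ 2 * (Fintype.card n : ℝ) * (D * (r ^ 2 / 2)) := mul_le_mul_of_nonneg_left hsingle (by positivity)
      _ = (Fintype.card n : ℝ) * D * r ^ 2 := by ring
  have hnn : 0 ≤ Real.sqrt ((Fintype.card n : ℝ) * D) * r := mul_nonneg (Real.sqrt_nonneg _) hr
  exact (pow_le_pow_iff_left₀ (norm_nonneg _) hnn two_ne_zero).1 hsq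

/-! ## §3 Restricted Fermat at every level, in the tangent currency -/

/-- **RESTRICTED FERMAT AT EVERY LEVEL** (the symmetric twin of `NE7OpenOfMinimisation.tanCritical_of_isMinimiser`): `U` admissible for `sfClass d L N ε` at level `k+1` over
`V`, FIXED by the block-constant lifts of a set `K` of unitary `N`-periodic coarse site fields, of least level action among the lifted-`K`-fixed admissible
configurations, and INTERIOR (`SmallField U a`, `a < ε(L^{k+1})^{−2}`, `LevelSmall d L k (ε(L^{k+1})^{−2})`) ⟹ `dAction U φ (perWin) = 0` for every skew
`(N·L^{k+1})`-periodic `U`-tangent `φ` that is INVARIANT under the lifted `K`. [folklore] -/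
theorem tanCritical_of_isRestrictedMinimiser [Nonempty n] {L N k : ℕ} [NeZero L] [NeZero N] (hL : 1 ≤ L) {ε a : ℝ}
    {V U : Site d → Fin d → (Matrix n n ℂ)ˣ} (hUadm : U ∈ admissible (sfClass d L N ε) L (k + 1) V)
    (K : Set (Site d → (Matrix n n ℂ)ˣ)) (hKu : ∀ s ∈ K, IsUnitarySite s) (hKP : ∀ s ∈ K, IsPeriodicSite s (N : ℤ))
    (hfix : ∀ s ∈ K, gaugeAct (fun x : Site d => s (fun i => x i / ((L : ℤ) ^ (k + 1)))) U = U)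
    (hminK : ∀ U' ∈ admissible (sfClass d L N ε) L (k + 1) V,
      (∀ s ∈ K, gaugeAct (fun x : Site d => s (fun i => x i / ((L : ℤ) ^ (k + 1)))) U' = U') →
        levelAction d L N (k + 1) U ≤ levelAction d L N (k + 1) U')
    (ha0 : 0 ≤ a) (haε : a < ε / ((L : ℝ) ^ (k + 1)) ^ 2) (hUa : SmallField U a) (hls : LevelSmall d L k (ε / ((L : ℝ) ^ (k + 1)) ^ 2)) :
    ∀ φ : Site d → Fin d → Matrix n n ℂ, IsSkewDir φ → IsPeriodicDir φ ((N * L ^ (k + 1) : ℕ) : ℤ) → TangentIter L k U φ →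
      (∀ s ∈ K, (fun y μ => Ad ((fun x : Site d => s (fun i => x i / ((L : ℤ) ^ (k + 1)))) (y + e μ)) (φ y μ)) = φ) →
      dAction U φ (perWin d (N * L ^ (k + 1))) = 0 := by
  intro φ hφs hφP hφT hφK
  obtain ⟨⟨hUu, hUP, hUε⟩, hUavg⟩ := hUadm
  have hLk : 1 ≤ L ^ (k + 1) := Nat.one_le_pow _ _ hL
  have hcast : (((L ^ (k + 1) : ℕ) : ℤ)) = (L : ℤ) ^ (k + 1) := by push_cast; ring
  -- the lifted gauge transformations
  set 𝒦 : Set (Site d → (Matrix n n ℂ)ˣ) := (fun s : Site d → (Matrix n n ℂ)ˣ => fun x : Site d => s (fun i => x i / ((L : ℤ) ^ (k + 1)))) '' K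
    with h𝒦
  have h𝒦u : ∀ g ∈ 𝒦, IsUnitarySite g := by
    rintro _ ⟨s, hs, rfl⟩; exact isUnitarySite_lift (hKu s hs) _
  have h𝒦P : ∀ g ∈ 𝒦, IsPeriodicSite g ((N * L ^ (k + 1) : ℕ) : ℤ) := by
    rintro _ ⟨s, hs, rfl⟩
    have h := isPeriodicSite_lift (hKP s hs) hLk
    rw [hcast] at h
    exact h
  have h𝒦fix : ∀ g ∈ 𝒦, gaugeAct g U = U := by
    rintro _ ⟨s, hs, rfl⟩; exact hfix s hs
  have hφK' : ∀ g ∈ 𝒦, (fun y μ => Ad (g (y + e μ)) (φ y μ)) = φ := by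
    rintro _ ⟨s, hs, rfl⟩; exact hφK s hs
  have hfix' : ∀ U' : Site d → Fin d → (Matrix n n ℂ)ˣ, (∀ g ∈ 𝒦, gaugeAct g U' = U') →
      ∀ s ∈ K, gaugeAct (fun x : Site d => s (fun i => x i / ((L : ℤ) ^ (k + 1)))) U' = U' :=
    fun U' h s hs => h _ ⟨s, hs, rfl⟩
  have hw : 0 < ((stepWt d L)⁻¹) ^ (k + 1) := pow_pos (inv_pos.mpr (stepWt_pos (d := d) L hL)) _
  cases k with
  | zero =>
      have eP : ((N * L ^ (0 + 1) : ℕ) : ℤ) = (L : ℤ) * N := by push_cast; ring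
      have hUP' : IsPeriodicCfg U ((L : ℤ) * N) := by rw [← eP]; exact hUP
      have hφP' : IsPeriodicDir φ ((L : ℤ) * N) := by rw [← eP]; exact hφP
      have h𝒦P' : ∀ g ∈ 𝒦, IsPeriodicSite g ((L * N : ℕ) : ℤ) := by
        intro g hg; have h := h𝒦P g hg; rwa [show ((N * L ^ (0 + 1) : ℕ) : ℤ) = ((L * N : ℕ) : ℤ) by push_cast; ring] at h
      -- the restricted minimality in the raw one-level form
      have hmin : ∀ W : Site d → Fin d → (Matrix n n ℂ)ˣ, IsUnitaryCfg W → IsPeriodicCfg W ((L : ℤ) * N) →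
          SmallField W (ε / ((L : ℝ) ^ (0 + 1)) ^ 2) → (∀ g ∈ 𝒦, gaugeAct g W = W) → cavg L W = cavg L U →
            fineAction U (blockWindow L (periodBox (d := d) N)).2 ≤ fineAction W (blockWindow L (periodBox (d := d) N)).2 := by
        intro W hW hWP hWε hWfix hWavg
        have hWP' : IsPeriodicCfg W ((N * L ^ (0 + 1) : ℕ) : ℤ) := by rw [eP]; exact hWP
        have hadm : W ∈ admissible (sfClass d L N ε) L (0 + 1) V := by
          refine ⟨⟨hW, hWP', hWε⟩, ?_⟩
          rw [← cavgIter_eq_avgIter] at hUavg ⊢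
          show cavg L W = V
          rw [hWavg]; exact hUavg
        have hle := hminK W hadm (hfix' W hWfix)
        unfold levelAction at hle
        have e : N * L ^ (0 + 1) = L * N := by ring
        rw [e] at hle
        rw [blockWindow_periodBox_snd L _ hL]
        exact le_of_mul_le_mul_left hle hw
      have hT : cpush L U φ = 0 := hφT
      have h := hasDerivAt_fineAction_vary_oneLevel_symmetric hUu hUP' ha0 haε hls hUa 𝒦 h𝒦u h𝒦P' h𝒦fix hmin hφs hφP' hφK' hT
      have e : N * L ^ (0 + 1) = L * N := by ring
      rw [e, ← blockWindow_periodBox_snd L N hL]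
      exact dAction_eq_zero_of_critical h
  | succ j =>
      have hUP' : IsPeriodicCfg U ((L : ℤ) * (L * tower L N j : ℕ)) := by rw [period_eq_int]; exact hUP
      have hφP' : IsPeriodicDir φ ((L : ℤ) * (L * tower L N j : ℕ)) := by rw [period_eq_int]; exact hφP
      have h𝒦P' : ∀ g ∈ 𝒦, IsPeriodicSite g ((L * (L * tower L N j) : ℕ) : ℤ) := by
        intro g hg; have h := h𝒦P g hg; rwa [← period_eq L N j] at h
      -- the restricted minimality in the raw multi-level form
      have hmin : ∀ U' : Site d → Fin d → (Matrix n n ℂ)ˣ, IsUnitaryCfg U' → IsPeriodicCfg U' ((L : ℤ) * (L * tower L N j : ℕ)) →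
          SmallField U' (ε / ((L : ℝ) ^ (j + 2)) ^ 2) → (∀ g ∈ 𝒦, gaugeAct g U' = U') → cavgIter L (j + 2) U' = cavgIter L (j + 2) U →
            fineAction U (blockWindow L (periodBox (d := d) (L * tower L N j))).2
              ≤ fineAction U' (blockWindow L (periodBox (d := d) (L * tower L N j))).2 := by
        intro U' hU' hU'P hU'ε hU'fix hU'eq
        have hU'P' : IsPeriodicCfg U' ((N * L ^ (j + 2) : ℕ) : ℤ) := by rw [← period_eq_int]; exact hU'P
        have hadm : U' ∈ admissible (sfClass d L N ε) L (j + 2) V := by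
          refine ⟨⟨hU', hU'P', hU'ε⟩, ?_⟩
          rw [← cavgIter_eq_avgIter] at hUavg ⊢
          rw [hU'eq]; exact hUavg
        have hle := hminK U' hadm (hfix' U' hU'fix)
        unfold levelAction at hle
        rw [blockWindow_periodBox_snd L _ hL, period_eq]
        exact le_of_mul_le_mul_left hle hw
      have hT : TangentIter L j (cavg L U) (cpush L U φ) := hφT
      have h := hasDerivAt_fineAction_vary_multiLevel_symmetric j hUu hUP' ha0 haε hls hUa 𝒦 h𝒦u h𝒦P' h𝒦fix hmin hφs hφP' hφK' hT
      rw [← period_eq L N j, ← blockWindow_periodBox_snd L _ hL]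
      exact dAction_eq_zero_of_critical h

/-! ## §4 Full tangent-criticality of the symmetric restricted minimiser -/

/-- **THE SYMMETRIC RESTRICTED MINIMISER IS TANGENT-CRITICAL** (restricted Fermat §3 + Palais' symmetric criticality `NE7SymmetricCriticality`): under the hypotheses
of `tanCritical_of_isRestrictedMinimiser` (with `0 ≤ ε`), `dAction U φ (perWin) = 0` for EVERY skew `(N·L^{k+1})`-periodic `U`-tangent `φ`. [folklore] -/
theorem tanCritical_of_symmetricRestrictedMinimiser [Nonempty n] {L N k : ℕ} [NeZero L] [NeZero N] (hL : 1 ≤ L) {ε a : ℝ} (hε : 0 ≤ ε)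
    {V U : Site d → Fin d → (Matrix n n ℂ)ˣ} (hUadm : U ∈ admissible (sfClass d L N ε) L (k + 1) V)
    (K : Set (Site d → (Matrix n n ℂ)ˣ)) (hKu : ∀ s ∈ K, IsUnitarySite s) (hKP : ∀ s ∈ K, IsPeriodicSite s (N : ℤ))
    (hfix : ∀ s ∈ K, gaugeAct (fun x : Site d => s (fun i => x i / ((L : ℤ) ^ (k + 1)))) U = U)
    (hminK : ∀ U' ∈ admissible (sfClass d L N ε) L (k + 1) V,
      (∀ s ∈ K, gaugeAct (fun x : Site d => s (fun i => x i / ((L : ℤ) ^ (k + 1)))) U' = U') →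
        levelAction d L N (k + 1) U ≤ levelAction d L N (k + 1) U')
    (ha0 : 0 ≤ a) (haε : a < ε / ((L : ℝ) ^ (k + 1)) ^ 2) (hUa : SmallField U a) (hls : LevelSmall d L k (ε / ((L : ℝ) ^ (k + 1)) ^ 2)) :
    ∀ φ : Site d → Fin d → Matrix n n ℂ, IsSkewDir φ → IsPeriodicDir φ ((N * L ^ (k + 1) : ℕ) : ℤ) → TangentIter L k U φ →
      dAction U φ (perWin d (N * L ^ (k + 1))) = 0 := by
  intro φ hφs hφP hφT
  haveI : NeZero (N * L ^ (k + 1)) := ⟨Nat.mul_ne_zero (NeZero.ne N) (pow_ne_zero _ (NeZero.ne L))⟩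
  have hLk : 1 ≤ L ^ (k + 1) := Nat.one_le_pow _ _ hL
  have hcast : (((L ^ (k + 1) : ℕ) : ℤ)) = (L : ℤ) ^ (k + 1) := by push_cast; ring
  have hx : 0 ≤ ε / ((L : ℝ) ^ (k + 1)) ^ 2 := by positivity
  set 𝒦 : Set (Site d → (Matrix n n ℂ)ˣ) := (fun s : Site d → (Matrix n n ℂ)ˣ => fun x : Site d => s (fun i => x i / ((L : ℤ) ^ (k + 1)))) '' K
    with h𝒦
  have h𝒦u : ∀ g ∈ 𝒦, IsUnitarySite g := by
    rintro _ ⟨s, hs, rfl⟩; exact isUnitarySite_lift (hKu s hs) _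
  have h𝒦P : ∀ g ∈ 𝒦, IsPeriodicSite g ((N * L ^ (k + 1) : ℕ) : ℤ) := by
    rintro _ ⟨s, hs, rfl⟩
    have h := isPeriodicSite_lift (hKP s hs) hLk
    rw [hcast] at h
    exact h
  have h𝒦fix : ∀ g ∈ 𝒦, gaugeAct g U = U := by
    rintro _ ⟨s, hs, rfl⟩; exact hfix s hs
  obtain ⟨⟨hUu, -, hUε⟩, -⟩ := id hUadm
  have hcrit : ∀ ψ : Site d → Fin d → Matrix n n ℂ, IsSkewDir ψ → IsPeriodicDir ψ ((N * L ^ (k + 1) : ℕ) : ℤ) → TangentIter L k U ψ →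
      (∀ g ∈ 𝒦, (fun y μ => Ad (g (y + e μ)) (ψ y μ)) = ψ) → dAction U ψ (perWin d (N * L ^ (k + 1))) = 0 := by
    intro ψ hψs hψP hψT hψK
    have hψK' : ∀ s ∈ K, (fun y μ => Ad ((fun x : Site d => s (fun i => x i / ((L : ℤ) ^ (k + 1)))) (y + e μ)) (ψ y μ)) = ψ :=
      fun s hs => hψK (fun x : Site d => s (fun i => x i / ((L : ℤ) ^ (k + 1))))
        (Set.mem_image_of_mem (fun s : Site d → (Matrix n n ℂ)ˣ => fun x : Site d => s (fun i => x i / ((L : ℤ) ^ (k + 1)))) hs)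
    exact tanCritical_of_isRestrictedMinimiser hL hUadm K hKu hKP hfix hminK ha0 haε hUa hls ψ hψs hψP hψT hψK'
  have h := dAction_eq_zero_of_symmetric (d := d) (n := n) (P := N * L ^ (k + 1)) (x := ε / ((L : ℝ) ^ (k + 1)) ^ 2) hL k hUu hx hls hUε 𝒦
    h𝒦u h𝒦P h𝒦fix (perWin d (N * L ^ (k + 1))) hcrit (φ := φ) hφs hφP hφT
  exact h

end

end Summit.QuantumFields.BalabanUV.T4Continuum.NE7StabiliserLiftingPrep
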